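import Mathlib.RingTheory.Kaehler.Basic
import Mathlib.RingTheory.Unramified.Basic
import Mathlib.RingTheory.Ideal.IdempotentFG
import Mathlib.RingTheory.LocalProperties.Basic
import Mathlib.RingTheory.Localization.AtPrime.Basic
import HarnessLib

/-!
# Crux `FrobeniusLadder.FRationalResolution` (stmt-ResolutionOfSingularities-15317), line `redirect`,
# stub `stub_diagonalizableQuotientResolution` — the descent datum of a `𝔔`-primary centre is a condition at the
# primes of `C ⊗_B C` over `(𝔔, 𝔔)`, automatic at those containing the diagonal ideal; trivial residue extension
# ⇒ descent datum (E-k re-derived from fpqc descent)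

Generic commutative algebra for brick «E-k by descent datum» (`…DescentDatumCentre`). `B → C` a ring map, `𝔔 ⊆ C` a
maximal ideal which is the ONLY prime over `𝔭 = 𝔔 ∩ B`, `J ⊇ 𝔔ⁿ` (a `𝔔`-primary centre), `D = C ⊗_B C` with
coprojections `i₁ = includeLeft`, `i₂ = includeRight` and diagonal ideal `ℑ = ker (D → C)` (Mathlib
`KaehlerDifferential.ideal`).

* `map_includeLeft_le_of_local` — **the datum `J ⊗ C ⊆ C ⊗ J` holds as soon as it holds in `D_𝔚` for every maximal
  `𝔚 ⊆ D` with `i₁⁻¹ 𝔚 = 𝔔 = i₂⁻¹ 𝔚`** (at every other maximal ideal `C ⊗ J` localizes to `D_𝔚`: ideals are compared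
  locally, Mathlib `Ideal.le_of_localization_maximal`);
* `map_map_includeLeft_eq_of_ideal_le` — for `C` formally unramified and essentially of finite type over `B`, at a
  prime `𝔚 ⊇ ℑ` the two extensions AGREE: `ℑ` is finitely generated and idempotent (`Ω_{C/B} = ℑ/ℑ² = 0`), so
  `ℑ = (e)` with `e² = e ∈ 𝔚`, whence `ℑ D_𝔚 = 0` and `x ⊗ 1 = 1 ⊗ x` in `D_𝔚`;
* `ideal_le_of_residue_surjective` — if every `c ∈ C` is `≡ b (mod 𝔔)` for some `b ∈ B` (trivial residue
  extension), every prime `𝔚` over `(𝔔, 𝔔)` contains `ℑ` (`1 ⊗ c − c ⊗ 1 = i₂ q − i₁ q`, `q = c − b ∈ 𝔔`);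
* **`map_includeLeft_le_of_residue_surjective`** — hence, for `C` formally unramified and essentially of finite
  type over `B`: trivial residue extension at the unique prime `𝔔` over `𝔭` ⇒ the descent datum for every
  `J ⊇ 𝔔ⁿ` (the residue-trivial brick E-k `…CentreDescent` is the special case of descent in which `D` has only
  the diagonal prime over `(𝔔, 𝔔)`).

Honest label: generic bricks (no stub closed by name). No definitions, no named facts, no sorry.
[cite: StacksProject, Tag 0245; Tag 00UW] [cite: EGAIV4, Prop. (17.2.1), (16.3.1)]
-/

noncomputable section

-- single-problem summit: the doubled namespace component is forced
set_option linter.dupNamespace false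

open TensorProduct

namespace Summit.ResolutionOfSingularities.ResolutionOfSingularities.Theorems.FRationalResolution.DescentDatumLocal

universe u v

variable {B : Type u} {C : Type v} [CommRing B] [CommRing C] [Algebra B C]

/-- If `φ ∘ f` and `φ ∘ g` agree on an ideal `J`, then `φ (f J) = φ (g J)` as extended ideals. [folklore] -/
theorem map_map_eq_of_eqOn {D E : Type*} [CommRing D] [Algebra B D] [CommRing E] (J : Ideal C)
    (f g : C →ₐ[B] D)
    (φ : D →+* E) (h : ∀ x ∈ J, φ (f x) = φ (g x)) : (J.map f).map φ = (J.map g).map φ := by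
  apply le_antisymm
  · rw [Ideal.map_le_iff_le_comap, Ideal.map_le_iff_le_comap]
    intro x hx
    rw [Ideal.mem_comap, Ideal.mem_comap, h x hx]
    exact Ideal.mem_map_of_mem φ (Ideal.mem_map_of_mem g hx)
  · rw [Ideal.map_le_iff_le_comap, Ideal.map_le_iff_le_comap]
    intro x hx
    rw [Ideal.mem_comap, Ideal.mem_comap, ← h x hx]
    exact Ideal.mem_map_of_mem φ (Ideal.mem_map_of_mem f hx)

/-- The coprojections restrict to `algebraMap B (C ⊗_B C)` on `B`. [folklore] -/
theorem comap_includeLeft_comap_eq_comap_includeRight_comap (𝔚 : Ideal (C ⊗[B] C)) :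
    (𝔚.comap (Algebra.TensorProduct.includeLeft : C →ₐ[B] C ⊗[B] C)).comap (algebraMap B C) =
      (𝔚.comap (Algebra.TensorProduct.includeRight : C →ₐ[B] C ⊗[B] C)).comap (algebraMap B C) := by
  ext b
  simp only [Ideal.mem_comap, AlgHom.commutes]

/-- **The descent datum is a condition at the primes over `(𝔔, 𝔔)`.** Let `𝔔 ⊆ C` be maximal and the only prime of
`C` over `𝔔 ∩ B`, and `J ⊇ 𝔔ⁿ`. If `(J ⊗ C) D_𝔚 ⊆ (C ⊗ J) D_𝔚` for every maximal `𝔚 ⊆ D = C ⊗_B C` with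
`i₁⁻¹ 𝔚 = 𝔔 = i₂⁻¹ 𝔚`, then `J ⊗ C ⊆ C ⊗ J`. (At a maximal `𝔚` not containing `C ⊗ J` the right side localizes to
`D_𝔚`; if `𝔚 ⊇ C ⊗ J ⊇ C ⊗ 𝔔ⁿ` then `i₂⁻¹ 𝔚 = 𝔔`, and `i₁⁻¹ 𝔚` is a prime over `𝔔 ∩ B`, hence `= 𝔔`.)
[cite: StacksProject, Tag 0245] -/
theorem map_includeLeft_le_of_local (𝔔 : Ideal C) [h𝔔 : 𝔔.IsMaximal]
    (huniq : ∀ 𝔔' : Ideal C, 𝔔'.IsPrime → 𝔔'.comap (algebraMap B C) = 𝔔.comap (algebraMap B C) → 𝔔' = 𝔔)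
    (J : Ideal C) {n : ℕ} (hJ : 𝔔 ^ n ≤ J)
    (hloc : ∀ (𝔚 : Ideal (C ⊗[B] C)) (_ : 𝔚.IsMaximal),
      𝔚.comap (Algebra.TensorProduct.includeLeft : C →ₐ[B] C ⊗[B] C) = 𝔔 →
      𝔚.comap (Algebra.TensorProduct.includeRight : C →ₐ[B] C ⊗[B] C) = 𝔔 →
      (J.map (Algebra.TensorProduct.includeLeft : C →ₐ[B] C ⊗[B] C)).map
          (algebraMap (C ⊗[B] C) (Localization.AtPrime 𝔚)) ≤
        (J.map (Algebra.TensorProduct.includeRight : C →ₐ[B] C ⊗[B] C)).map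
          (algebraMap (C ⊗[B] C) (Localization.AtPrime 𝔚))) :
    J.map (Algebra.TensorProduct.includeLeft : C →ₐ[B] C ⊗[B] C) ≤
      J.map (Algebra.TensorProduct.includeRight : C →ₐ[B] C ⊗[B] C) := by
  refine Ideal.le_of_localization_maximal fun 𝔚 h𝔚 => ?_
  by_cases hW : J.map (Algebra.TensorProduct.includeRight : C →ₐ[B] C ⊗[B] C) ≤ 𝔚
  · -- `𝔚` lies over `(𝔔, 𝔔)`
    have h2 : 𝔚.comap (Algebra.TensorProduct.includeRight : C →ₐ[B] C ⊗[B] C) = 𝔔 := by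
      have hprime : (𝔚.comap (Algebra.TensorProduct.includeRight : C →ₐ[B] C ⊗[B] C)).IsPrime :=
        Ideal.IsPrime.comap _
      have hle : 𝔔 ≤ 𝔚.comap (Algebra.TensorProduct.includeRight : C →ₐ[B] C ⊗[B] C) := by
        intro q hq
        have hqn : q ^ n ∈ J := hJ (Ideal.pow_mem_pow hq n)
        exact hprime.mem_of_pow_mem n (Ideal.map_le_iff_le_comap.mp hW hqn)
      exact (h𝔔.eq_of_le hprime.ne_top hle).symm
    have h1 : 𝔚.comap (Algebra.TensorProduct.includeLeft : C →ₐ[B] C ⊗[B] C) = 𝔔 := by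
      refine huniq _ (Ideal.IsPrime.comap _) ?_
      rw [comap_includeLeft_comap_eq_comap_includeRight_comap, h2]
    exact hloc 𝔚 h𝔚 h1 h2
  · -- `C ⊗ J ⊄ 𝔚`: its localization at `𝔚` is everything
    obtain ⟨x, hxJ, hx𝔚⟩ := Set.not_subset.mp hW
    have hunit : IsUnit (algebraMap (C ⊗[B] C) (Localization.AtPrime 𝔚) x) :=
      IsLocalization.map_units (Localization.AtPrime 𝔚) (⟨x, hx𝔚⟩ : 𝔚.primeCompl)
    have htop : (J.map (Algebra.TensorProduct.includeRight : C →ₐ[B] C ⊗[B] C)).map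
        (algebraMap (C ⊗[B] C) (Localization.AtPrime 𝔚)) = ⊤ :=
      Ideal.eq_top_of_isUnit_mem _ (Ideal.mem_map_of_mem _ hxJ) hunit
    rw [htop]
    exact le_top

/-- **At a prime containing the diagonal ideal the two extensions agree** (`C` formally unramified and essentially
of finite type over `B`): `ℑ = ker (C ⊗_B C → C)` is finitely generated and idempotent (`Ω_{C/B} = ℑ/ℑ² = 0`), so
`ℑ = (e)` with `e² = e`; at a prime `𝔚 ∋ e` the idempotent `e` becomes `0`, so `ℑ D_𝔚 = 0` and `x ⊗ 1 = 1 ⊗ x` in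
`D_𝔚` for every `x ∈ C`. [cite: EGAIV4, Prop. (17.2.1), (16.3.1)] -/
theorem map_map_includeLeft_eq_of_ideal_le [Algebra.FormallyUnramified B C] [Algebra.EssFiniteType B C]
    (J : Ideal C) (𝔚 : Ideal (C ⊗[B] C)) [𝔚.IsPrime] (hI : KaehlerDifferential.ideal B C ≤ 𝔚) :
    (J.map (Algebra.TensorProduct.includeLeft : C →ₐ[B] C ⊗[B] C)).map
        (algebraMap (C ⊗[B] C) (Localization.AtPrime 𝔚)) =
      (J.map (Algebra.TensorProduct.includeRight : C →ₐ[B] C ⊗[B] C)).map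
        (algebraMap (C ⊗[B] C) (Localization.AtPrime 𝔚)) := by
  -- `ℑ` is idempotent and finitely generated, hence principal on an idempotent
  have hΩ : Subsingleton (KaehlerDifferential.ideal B C).Cotangent := inferInstanceAs (Subsingleton Ω[C⁄B])
  have hidem : IsIdempotentElem (KaehlerDifferential.ideal B C) := (Ideal.cotangent_subsingleton_iff _).mp hΩ
  obtain ⟨e, he, hIe⟩ :=
    (Ideal.isIdempotentElem_iff_of_fg _ (KaehlerDifferential.ideal_fg B C)).mp hidem
  -- `e ↦ 0` in `D_𝔚`
  set φ := algebraMap (C ⊗[B] C) (Localization.AtPrime 𝔚) with hφ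
  have heI : e ∈ KaehlerDifferential.ideal B C := by
    rw [hIe]
    exact Submodule.mem_span_singleton_self e
  have he0 : φ e = 0 := by
    have hemax : φ e ∈ IsLocalRing.maximalIdeal (Localization.AtPrime 𝔚) :=
      (IsLocalization.AtPrime.to_map_mem_maximal_iff (Localization.AtPrime 𝔚) 𝔚 e).mpr (hI heI)
    have hunit : IsUnit (1 - φ e) := by
      by_contra h
      have hmem : 1 - φ e ∈ IsLocalRing.maximalIdeal (Localization.AtPrime 𝔚) := h
      have : (1 : Localization.AtPrime 𝔚) ∈ IsLocalRing.maximalIdeal _ := by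
        have := Ideal.add_mem _ hmem hemax
        rwa [sub_add_cancel] at this
      exact (IsLocalRing.maximalIdeal.isMaximal _).ne_top ((Ideal.eq_top_iff_one _).mpr this)
    have hmul : φ e * (1 - φ e) = 0 := by
      rw [mul_sub, mul_one, ← map_mul, he.eq, sub_self]
    exact (hunit.mul_left_eq_zero).mp hmul
  -- `ℑ D_𝔚 = 0`
  have hI0 : ∀ y ∈ KaehlerDifferential.ideal B C, φ y = 0 := by
    intro y hy
    rw [hIe] at hy
    obtain ⟨r, rfl⟩ := Ideal.mem_span_singleton'.mp hy
    rw [map_mul, he0, mul_zero]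
  -- the two composites agree on every `x ∈ C`
  refine map_map_eq_of_eqOn J _ _ φ fun x _ => ?_
  have hx : (1 : C) ⊗ₜ[B] x - x ⊗ₜ[B] (1 : C) ∈ KaehlerDifferential.ideal B C :=
    KaehlerDifferential.one_smul_sub_smul_one_mem_ideal B x
  have h := hI0 _ hx
  rw [map_sub, sub_eq_zero] at h
  change φ (x ⊗ₜ[B] (1 : C)) = φ ((1 : C) ⊗ₜ[B] x)
  exact h.symm

/-- **Trivial residue extension ⇒ every prime over `(𝔔, 𝔔)` contains the diagonal ideal**: if every `c ∈ C` is
`≡ b (mod 𝔔)` for some `b` from `B`, then `1 ⊗ c − c ⊗ 1 = i₂ q − i₁ q` with `q = c − b ∈ 𝔔` lies in every `𝔚`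
with `i₁⁻¹ 𝔚 = 𝔔 = i₂⁻¹ 𝔚`. [cite: StacksProject, Tag 00UW] -/
theorem ideal_le_of_residue_surjective (𝔔 : Ideal C) (hres : ∀ c : C, ∃ b : B, c - algebraMap B C b ∈ 𝔔)
    (𝔚 : Ideal (C ⊗[B] C))
    (h1 : 𝔚.comap (Algebra.TensorProduct.includeLeft : C →ₐ[B] C ⊗[B] C) = 𝔔)
    (h2 : 𝔚.comap (Algebra.TensorProduct.includeRight : C →ₐ[B] C ⊗[B] C) = 𝔔) :
    KaehlerDifferential.ideal B C ≤ 𝔚 := by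
  rw [← KaehlerDifferential.span_range_eq_ideal, Ideal.span_le]
  rintro _ ⟨c, rfl⟩
  obtain ⟨b, hb⟩ := hres c
  set q : C := c - algebraMap B C b with hq
  have hbb : (algebraMap B C b) ⊗ₜ[B] (1 : C) = (1 : C) ⊗ₜ[B] (algebraMap B C b) := by
    rw [Algebra.algebraMap_eq_smul_one, TensorProduct.smul_tmul]
  have hdecomp : (1 : C) ⊗ₜ[B] c - c ⊗ₜ[B] (1 : C) = (1 : C) ⊗ₜ[B] q - q ⊗ₜ[B] (1 : C) := by
    rw [hq, TensorProduct.tmul_sub, TensorProduct.sub_tmul, hbb]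
    abel
  change (1 : C) ⊗ₜ[B] c - c ⊗ₜ[B] (1 : C) ∈ 𝔚
  rw [hdecomp]
  refine Ideal.sub_mem _ ?_ ?_
  · have : q ∈ 𝔚.comap (Algebra.TensorProduct.includeRight : C →ₐ[B] C ⊗[B] C) := by rw [h2]; exact hb
    exact this
  · have : q ∈ 𝔚.comap (Algebra.TensorProduct.includeLeft : C →ₐ[B] C ⊗[B] C) := by rw [h1]; exact hb
    exact this

/-- **Trivial residue extension ⇒ descent datum.** For `C` formally unramified and essentially of finite type over
`B`, `𝔔 ⊆ C` maximal and the only prime over `𝔔 ∩ B`, with every `c ∈ C` congruent mod `𝔔` to an element of `B`: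
every `J ⊇ 𝔔ⁿ` satisfies `J ⊗ C ⊆ C ⊗ J` in `C ⊗_B C`. (So the residue-trivial descent of the centre,
`…CentreDescent`, is fpqc descent in the case where `C ⊗_B C` has only diagonal primes over `(𝔔, 𝔔)`.)
[cite: StacksProject, Tag 0245; Tag 00UW] -/
theorem map_includeLeft_le_of_residue_surjective [Algebra.FormallyUnramified B C] [Algebra.EssFiniteType B C]
    (𝔔 : Ideal C) [𝔔.IsMaximal]
    (huniq : ∀ 𝔔' : Ideal C, 𝔔'.IsPrime → 𝔔'.comap (algebraMap B C) = 𝔔.comap (algebraMap B C) → 𝔔' = 𝔔)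
    (hres : ∀ c : C, ∃ b : B, c - algebraMap B C b ∈ 𝔔)
    (J : Ideal C) {n : ℕ} (hJ : 𝔔 ^ n ≤ J) :
    J.map (Algebra.TensorProduct.includeLeft : C →ₐ[B] C ⊗[B] C) ≤
      J.map (Algebra.TensorProduct.includeRight : C →ₐ[B] C ⊗[B] C) :=
  map_includeLeft_le_of_local 𝔔 huniq J hJ fun 𝔚 _ h1 h2 =>
    (map_map_includeLeft_eq_of_ideal_le J 𝔚 (ideal_le_of_residue_surjective 𝔔 hres 𝔚 h1 h2)).le

/-- **Only the OFF-DIAGONAL primes over `(𝔔, 𝔔)` matter** (`C` formally unramified and essentially of finite type over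
`B`, `𝔔` maximal and the only prime over `𝔔 ∩ B`, `J ⊇ 𝔔ⁿ`): if `(J ⊗ C) D_𝔚 ⊆ (C ⊗ J) D_𝔚` for every maximal
`𝔚 ⊆ C ⊗_B C` with `i₁⁻¹ 𝔚 = 𝔔 = i₂⁻¹ 𝔚` which does NOT contain the diagonal ideal `ℑ = ker (C ⊗_B C → C)` — the
points of `Spec (κ(𝔔) ⊗_{κ(𝔭)} κ(𝔔))` off the diagonal — then the descent datum `J ⊗ C ⊆ C ⊗ J` holds (at the primes
containing `ℑ` it is automatic, `map_map_includeLeft_eq_of_ideal_le`). This is the form in which a Galois-stable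
centre at a chart point with non-trivial residue extension is to be fed to `…DescentDatumCentre`.
[cite: StacksProject, Tag 0245] [cite: EGAIV4, Prop. (17.2.1)] -/
theorem map_includeLeft_le_of_offDiagonal [Algebra.FormallyUnramified B C] [Algebra.EssFiniteType B C]
    (𝔔 : Ideal C) [𝔔.IsMaximal]
    (huniq : ∀ 𝔔' : Ideal C, 𝔔'.IsPrime → 𝔔'.comap (algebraMap B C) = 𝔔.comap (algebraMap B C) → 𝔔' = 𝔔)
    (J : Ideal C) {n : ℕ} (hJ : 𝔔 ^ n ≤ J)
    (hoff : ∀ (𝔚 : Ideal (C ⊗[B] C)) (_ : 𝔚.IsMaximal),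
      𝔚.comap (Algebra.TensorProduct.includeLeft : C →ₐ[B] C ⊗[B] C) = 𝔔 →
      𝔚.comap (Algebra.TensorProduct.includeRight : C →ₐ[B] C ⊗[B] C) = 𝔔 →
      ¬ KaehlerDifferential.ideal B C ≤ 𝔚 →
      (J.map (Algebra.TensorProduct.includeLeft : C →ₐ[B] C ⊗[B] C)).map
          (algebraMap (C ⊗[B] C) (Localization.AtPrime 𝔚)) ≤
        (J.map (Algebra.TensorProduct.includeRight : C →ₐ[B] C ⊗[B] C)).map
          (algebraMap (C ⊗[B] C) (Localization.AtPrime 𝔚))) :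
    J.map (Algebra.TensorProduct.includeLeft : C →ₐ[B] C ⊗[B] C) ≤
      J.map (Algebra.TensorProduct.includeRight : C →ₐ[B] C ⊗[B] C) := by
  refine map_includeLeft_le_of_local 𝔔 huniq J hJ fun 𝔚 h𝔚 h1 h2 => ?_
  by_cases hI : KaehlerDifferential.ideal B C ≤ 𝔚
  · exact (map_map_includeLeft_eq_of_ideal_le J 𝔚 hI).le
  · exact hoff 𝔚 h𝔚 h1 h2 hI

/-- **The unique-prime hypothesis from the basic open of `…FibreReduced`.** Let `𝔔 ⊆ C` be maximal with
`𝔔 ∩ B = 𝔭`, `g ∉ 𝔔`, and `C' = C_g` with `𝔔 C_g ⊆ 𝔭 C_g` (over `D(g)` the fibre of `𝔭` is `V(𝔔)`). Then `𝔔 C_g` is a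
maximal ideal over `𝔭` and the ONLY prime of `C_g` over `𝔭` (ideals of `C_g` are extended from `C`).
[cite: StacksProject, Tag 00UW] -/
theorem unique_prime_over_of_away (𝔭 : Ideal B) (𝔔 : Ideal C) [h𝔔 : 𝔔.IsMaximal]
    (hover : 𝔔.comap (algebraMap B C) = 𝔭) (g : C) (hg : g ∉ 𝔔)
    (C' : Type*) [CommRing C'] [Algebra C C'] [IsLocalization.Away g C'] [Algebra B C'] [IsScalarTower B C C']
    (hle : 𝔔.map (algebraMap C C') ≤ 𝔭.map (algebraMap B C')) :
    (𝔔.map (algebraMap C C')).IsMaximal ∧ (𝔔.map (algebraMap C C')).comap (algebraMap B C') = 𝔭 ∧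
      ∀ 𝔔' : Ideal C', 𝔔'.IsPrime → 𝔔'.comap (algebraMap B C') = 𝔭 → 𝔔' = 𝔔.map (algebraMap C C') := by
  have hdisj : Disjoint ((Submonoid.powers g : Submonoid C) : Set C) (𝔔 : Set C) := by
    refine Set.disjoint_left.mpr ?_
    rintro x ⟨m, rfl⟩ hx
    exact hg (h𝔔.isPrime.mem_of_pow_mem m hx)
  have hprime : (𝔔.map (algebraMap C C')).IsPrime :=
    IsLocalization.isPrime_of_isPrime_disjoint (Submonoid.powers g) C' 𝔔 h𝔔.isPrime hdisj
  have hunder : (𝔔.map (algebraMap C C')).comap (algebraMap C C') = 𝔔 :=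
    IsLocalization.under_map_of_isPrime_disjoint (Submonoid.powers g) C' h𝔔.isPrime hdisj
  -- maximality: a strictly larger ideal contracts to an ideal strictly above the maximal `𝔔`
  have hmax : (𝔔.map (algebraMap C C')).IsMaximal := by
    refine ⟨⟨hprime.ne_top, fun 𝔑 hlt => ?_⟩⟩
    by_contra hne
    have hcomap : 𝔑.comap (algebraMap C C') = 𝔔 := by
      refine (h𝔔.eq_of_le (fun h => hne ((Ideal.comap_eq_top_iff).mp h)) ?_).symm
      rw [← hunder]
      exact Ideal.comap_mono hlt.le
    have h𝔑 : 𝔑 = 𝔔.map (algebraMap C C') := by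
      rw [← IsLocalization.map_under (Submonoid.powers g) C' 𝔑, Ideal.under_def, hcomap]
    exact hlt.ne' h𝔑
  have hcomapB : (𝔔.map (algebraMap C C')).comap (algebraMap B C') = 𝔭 := by
    rw [IsScalarTower.algebraMap_eq B C C', ← Ideal.comap_comap, hunder, hover]
  refine ⟨hmax, hcomapB, fun 𝔔' h𝔔' h' => ?_⟩
  -- `𝔔 C_g ⊆ 𝔭 C_g ⊆ 𝔔'`, and `𝔔 C_g` is maximal
  have hle' : 𝔔.map (algebraMap C C') ≤ 𝔔' :=
    hle.trans (Ideal.map_le_iff_le_comap.mpr (le_of_eq h'.symm))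
  exact (hmax.eq_of_le h𝔔'.ne_top hle').symm

end Summit.ResolutionOfSingularities.ResolutionOfSingularities.Theorems.FRationalResolution.DescentDatumLocal

end
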